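import Literature.MathematicalPhysics.QuantumFieldTheory.Balaban1983to89.B9Eq3119DeltaPiCarrier
import Literature.MathematicalPhysics.QuantumFieldTheory.Balaban1983to89.B9Eq319QprimeLipschitz

/-!
# `Balaban1983to89.B9Eq319BlockTentLift` — T. Bałaban, *Propagators for lattice gauge theories in a background field*, Commun. Math. Phys. **99**
# (1985) 389–434 [Balaban1985BackgroundPropagators] (3.19) p. 393 with (3.3)∕(3.11)∕(3.24) pp. 390–394: **BLOCK-MODULATED LIFTS `u = b·(ψ∘blk)` OF A
# COARSE GAUGE PARAMETER AND THE LIPSCHITZ TENT `t(x) = Π_μ k_μ(L−1−k_μ)` ON THE BLOCKS OF THE FINE TORUS, AT THE FLAT BACKGROUND** — the plain block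
# mean of a lift (`Q′(1)u = (L^{−d}Σ_B b)·ψ`), its Dirichlet form from a per-step bound (`‖η⁻¹D₁u‖² ≤ |η|⁻²D²d(c₀L^d∕c₁)‖ψ‖²`), the form of
# `Δ′_{a′}(1)`, `‖Q̃′(1)‖² ≤ c₁∕(c₀L^d)`, and the tent's per-step bound `L(L²∕4)^{d−1}` and block sum `(L(L−1)(L−2)∕6)^d`; the TEST-VECTOR KIT of
# `B9Eq365QGGQLowerVariational` (route R2′ STEP B7′ sub-step S3c of the pub-balaban NE9 chain)

statement-level skeleton of published theorems with citation tags; proofs where landed; nothing here is a claim about the Yang–Mills mass gap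

CITATION HEADER (lean-in-tree rule).  Audit cell `pub-balaban`, sub-cell `t4`, BINDER row NE9; filed by NE9 formalisation-swarm LEAF PROVER 01
(`b2b-balaban-t4-ne9-formalise-leaf-01`, gen 78) for sub-step S3c of route R2′ STEP B7′ (`t4/ROUTES-NE9.md` v13.19.1 l.408; first refusal transferred
by ne9-leaf-06 g63, journal l.45066).  Source READ in the held text layer (`paper:balaban1985-cmp99-background-propagators`, journal page = PDF page + 388):
p. 393 (3.15)∕(3.19) — *«(Q′(V)λ)(y) = Σ_{x∈B(y)} L^{−d} R(V(Γ_{y,x}))λ(x)»*, at `V = 1` the plain block mean ([Balaban1985Averaging] p. 27) — and pp. 390–394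
(3.3) `D`, (3.11) the weighted pairings, (3.24) `Δ′_a = Δ^η_U + Q′*aQ′`.

WHY (cell context).  The variational lower bound for Thm 3.11's third operator `Q′G′²Q′*` (S3c, `B9Eq365QGGQLowerVariational`) needs ONE explicit test
vector per coarse `ψ`: a lift of `ψ` to the fine torus modulated by a bump that vanishes on the block faces and moves by `O(L^{2d−1})` per lattice
step against a size `O(L^{2d})` — so that its Dirichlet form `‖η⁻¹D₁u‖²` is `(ηL)⁻²` times a number, NOT `η⁻²`.  This file is that kit: the
bookkeeping of blocks, offsets and forward steps on `TSite d (fineP L m)` (the tree's `blockCoord`∕`offset`∕`blockOf` of `B9Eq319QprimeTorus`, the block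
parametrisation `sum_blockOf_eq_sum_boxVec` of `B5Eq155FlatAveragingCommute`, the partition `sum_blockOf_sum` and Jensen `blockMean_norm_sq_le` of
`B9Eq319QprimeLipschitz`), all at the FLAT transporters (`adTransportW_one`, `hRS_one`).

WHAT IS PROVED (sorry-free; 0 `def`; axioms standard; [folklore] throughout; nothing of [B9] asserted).
* §1 THE PROFILE `p(k) = k(L−1−k)`: **`sum_profile_eq`** (`Σ_{k<L} p(k) = L(L−1)(L−2)∕6`), `profile_nonneg`, `profile_le` (`≤ L²∕4`),
  `abs_profile_succ_sub_le` (`≤ L` per step), `profile_last`; THE GEOMETRY OF A FORWARD STEP: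
  `offset_shift_self`, `offset_shift_of_ne`, `shift_apply_of_ne`, **`blockCoord_shift_of_lt`** (interior steps keep the block, offset `+1`),
  `offset_shift_of_eq` (face steps land on offset `0`).
* §2 LIFTS `u(x) = b(x)·ψ(blk x)` AT THE FLAT BACKGROUND (under `[Ring 𝔸] [Algebra ℂ 𝔸]`, any fibre reading `φ`): **`QprimeW_one_lift`** ∕ **`QprimeWL2_one_lift`**
  (`Q̃′(1)u = (L^{−d}B)·ψ` when every block sum of `b` is `B`), **`norm_sq_covDerivL2K_lift_le`** (a per-step bound `D‖ψ(blk x)‖` gives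
  `‖η⁻¹D₁u‖² ≤ |η⁻¹|²D²·d·(c₀L^d∕c₁)·‖ψ‖²`), **`re_inner_laplacePrimeA_one`** (`re⟪u, Δ′_{a′}(1)u⟫ = ‖η⁻¹D₁u‖² + a′‖Q̃′(1)u‖²`, EVERY `u`),
  **`norm_sq_QprimeWL2_one_le`** (`‖Q̃′(1)v‖² ≤ (c₁∕(c₀L^d))‖v‖²`).
* §3 THE TENT: **`sum_blockOf_tent`** (`Σ_{x∈B(y)} Π_μ p(offset_μ x) = (Σ_{k<L} p(k))^d`), **`norm_tent_step_le`**
  (`‖t(x+e_μ)ψ(blk(x+e_μ)) − t(x)ψ(blk x)‖ ≤ L(L²∕4)^{d−1}‖ψ(blk x)‖`: interior — one factor moves by `≤ L`, the others `≤ L²∕4`; face — both vanish).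
HONEST SCOPE.  Elementary; crude constants; flat background only; `Q̃′ := (WL2.linearEquiv ℂ ℂ (fun _ => c₁)).symm ∘ₗ QprimeW L m φ 1` is the reading of
`B9Eq3119DeltaPiCarrier.laplacePrimeA`; NOT NE9, NOT the route (cell pub-balaban: NE9 NOT PRINTED ∕ NOT PROVED; spine PROVED 0∕9; rung (B)+1 on a finite T⁴ —
NOT infinite volume, NOT mass gap, NOT Clay).  NEW file; imports `B9Eq3119DeltaPiCarrier`, `B9Eq319QprimeLipschitz`; nothing modified.  Net new unproved facts: 0.
-/

noncomputable section

open scoped InnerProductSpace ComplexConjugate BigOperators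

namespace Literature.MathematicalPhysics.QuantumFieldTheory.Balaban1983to89.B9Eq319BlockTentLift

open B4Sect5Torus (TSite)
open B9SectCLatticeCarrier (Bond shift bpos btgt)
open B9Eq311L2Pairing (WL2)
open B9Eq319QprimeTorus (fineP offset offset_lt blockCoord mem_blockOf_iff Qprime_flat QprimeLin_apply)
open B9Eq315QTorus (perSite cornerSite)
open B7Prop1Explicit (boxVec)
open B11Eq103H1Complex (SiteL2K BondL2K covDerivL2K covDivL2K covLaplaceSiteK equiv_covDerivL2K inner_covDivL2K_covDerivL2K)
open B9Eq33CovDerivVector (covDeriv covDeriv_apply)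
open B9Eq310HessianOperator (adTransportW)
open B5Eq172HodgePositivity (adTransportW_one hRS_one)
open B9Eq326OperatorAssembly (QprimeW)
open B9Eq3119DeltaPiCarrier (laplacePrimeA)
open B5Eq155FlatAveragingCommute (sum_blockOf_eq_sum_boxVec offset_perSite_cornerSite_add_boxVec)
open B5Eq172FlatCoercivity (card_blockOf)
open B9Eq319QprimeLipschitz (blockMean_norm_sq_le sum_blockOf_sum)

/-! ## §1 The tent profile `k(L−1−k)` and the block geometry of a forward step -/

section Profile

/-- **The tent profile's sum**: `6·Σ_{k<n} k(c − k) = n(n−1)(3c − 2n + 1)` (any real `c`) (private arithmetic helper). [folklore] -/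
private theorem six_mul_sum_range_mul_sub (c : ℝ) : ∀ n : ℕ, 6 * ∑ k ∈ Finset.range n, (k : ℝ) * (c - k) = n * (n - 1) * (3 * c - 2 * n + 1)
  | 0 => by simp
  | n + 1 => by
    rw [Finset.sum_range_succ, mul_add, six_mul_sum_range_mul_sub c n]
    push_cast
    ring

/-- `Σ_{k<L} k(L−1−k) = L(L−1)(L−2)∕6` — the block sum of the one-coordinate profile of the test field for the lower bound of `Q′G′²Q′*`
(print bounds the third operator below by Fourier representation, [Balaban1984PropagatorsII] (2.74)–(2.77); the cell's route is variational). [folklore]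
[cite: Balaban1984PropagatorsII, (2.74)–(2.77) p.236] -/
theorem sum_profile_eq (L : ℕ) : ∑ k ∈ Finset.range L, (k : ℝ) * ((L : ℝ) - 1 - k) = L * ((L : ℝ) - 1) * ((L : ℝ) - 2) / 6 := by
  have h := six_mul_sum_range_mul_sub ((L : ℝ) - 1) L
  have h' : (L : ℝ) * (L - 1) * (3 * ((L : ℝ) - 1) - 2 * L + 1) = L * ((L : ℝ) - 1) * ((L : ℝ) - 2) := by ring
  rw [h'] at h
  linarith

/-- the profile is nonnegative on a block: `0 ≤ k(L−1−k)` for `k < L`. [folklore] [cite: Balaban1984PropagatorsII, (2.74)–(2.77) p.236] -/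
theorem profile_nonneg {L k : ℕ} (hk : k < L) : 0 ≤ (k : ℝ) * ((L : ℝ) - 1 - k) := by
  have h1 : (k : ℝ) + 1 ≤ L := by exact_mod_cast hk
  exact mul_nonneg (Nat.cast_nonneg k) (by linarith)

/-- the profile is bounded by `L²∕4`. [folklore] [cite: Balaban1984PropagatorsII, (2.74)–(2.77) p.236] -/
theorem profile_le (L k : ℕ) : (k : ℝ) * ((L : ℝ) - 1 - k) ≤ (L : ℝ) ^ 2 / 4 := by
  nlinarith [sq_nonneg (2 * (k : ℝ) - ((L : ℝ) - 1)), sq_nonneg ((L : ℝ) - 1), (Nat.cast_nonneg L : (0 : ℝ) ≤ L)]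

/-- the profile is `L`-Lipschitz per step inside a block: `|(k+1)(L−2−k) − k(L−1−k)| = |L − 2 − 2k| ≤ L` for `k + 1 < L`. [folklore]
[cite: Balaban1984PropagatorsII, (2.74)–(2.77) p.236] -/
theorem abs_profile_succ_sub_le {L k : ℕ} (hk : k + 1 < L) :
    |((k : ℝ) + 1) * ((L : ℝ) - 1 - (k + 1)) - (k : ℝ) * ((L : ℝ) - 1 - k)| ≤ L := by
  have h1 : (k : ℝ) + 2 ≤ L := by exact_mod_cast hk
  have e : ((k : ℝ) + 1) * ((L : ℝ) - 1 - (k + 1)) - (k : ℝ) * ((L : ℝ) - 1 - k) = (L : ℝ) - 2 - 2 * k := by ring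
  rw [e, abs_le]
  constructor <;> nlinarith [(Nat.cast_nonneg k : (0 : ℝ) ≤ k)]

/-- the profile vanishes at the near face of the block (private helper). [folklore] -/
private theorem profile_zero (L : ℕ) : ((0 : ℕ) : ℝ) * ((L : ℝ) - 1 - (0 : ℕ)) = 0 := by simp

/-- the profile vanishes at the far face `k = L − 1` (stated as `k + 1 = L`). [folklore] [cite: Balaban1984PropagatorsII, (2.74)–(2.77) p.236] -/
theorem profile_last {L k : ℕ} (hk : k + 1 = L) : (k : ℝ) * ((L : ℝ) - 1 - k) = 0 := by
  have : (L : ℝ) = k + 1 := by exact_mod_cast hk.symm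
  rw [this]; ring

end Profile

section Geometry

variable {d : ℕ} (L : ℕ) [NeZero L] (m : Fin d → ℕ)

omit [NeZero L] in
/-- the offset along the stepped coordinate advances by one `mod L` (`L` divides the fine period `L·m_μ`) — the blocks `B(y)` of B7 (2). [folklore]
[cite: Balaban1985Averaging, (2) p.17] -/
theorem offset_shift_self (x : TSite d (fineP L m)) (μ : Fin d) : offset L m (shift μ x) μ = (offset L m x μ + 1) % L := by
  rw [offset, offset, B9SectCLatticeCarrier.shift_apply_val]
  show ((x μ : ℕ) + 1) % (L * m μ) % L = ((x μ : ℕ) % L + 1) % L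
  rw [Nat.mod_mul_right_mod, Nat.mod_add_mod]

omit [NeZero L] in
/-- the other offsets are unchanged under a step along `μ`. [folklore] [cite: Balaban1985Averaging, (2) p.17] -/
theorem offset_shift_of_ne (x : TSite d (fineP L m)) {μ ν : Fin d} (h : ν ≠ μ) : offset L m (shift μ x) ν = offset L m x ν := by
  rw [offset, offset, shift, Function.update_of_ne h]

omit [NeZero L] in
/-- the other coordinates are unchanged under a step along `μ`. [folklore] [cite: Balaban1985Averaging, (2) p.17] -/
theorem shift_apply_of_ne (x : TSite d (fineP L m)) {μ ν : Fin d} (h : ν ≠ μ) : shift μ x ν = x ν := by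
  rw [shift, Function.update_of_ne h]

/-- **interior steps stay in the block**: if the offset along `μ` is `< L − 1`, then `x + e_μ` has the same block coordinate and offset `+1` (B7 (2):
`y_μ ≦ x_μ < y_μ + L`). [folklore] [cite: Balaban1985Averaging, (2) p.17] -/
theorem blockCoord_shift_of_lt (x : TSite d (fineP L m)) {μ : Fin d} (hk : offset L m x μ + 1 < L) :
    blockCoord L m (shift μ x) = blockCoord L m x ∧ offset L m (shift μ x) μ = offset L m x μ + 1 := by
  have hL : 0 < L := Nat.pos_of_ne_zero (NeZero.ne L)
  have hk' : (x μ : ℕ) % L + 1 < L := hk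
  have hnd : ¬ L ∣ (x μ : ℕ) + 1 := by
    intro hdvd
    have h0 : ((x μ : ℕ) + 1) % L = 0 := Nat.mod_eq_zero_of_dvd hdvd
    rw [← Nat.mod_add_mod, Nat.mod_eq_of_lt hk'] at h0
    omega
  -- no wrap around the fine period either (`L ∣ L·m_μ`)
  have hlt : (x μ : ℕ) + 1 < L * m μ := by
    rcases Nat.lt_or_ge ((x μ : ℕ) + 1) (L * m μ) with h | h
    · exact h
    · exfalso
      have hle : (x μ : ℕ) + 1 ≤ L * m μ := (x μ).isLt
      have heq : (x μ : ℕ) + 1 = L * m μ := le_antisymm hle h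
      exact hnd ⟨m μ, heq⟩
  have hval : ((shift μ x) μ : ℕ) = (x μ : ℕ) + 1 := by
    rw [B9SectCLatticeCarrier.shift_apply_val]; exact Nat.mod_eq_of_lt hlt
  refine ⟨funext fun ν => Fin.ext ?_, ?_⟩
  · rw [B9Eq319QprimeTorus.blockCoord_apply_val, B9Eq319QprimeTorus.blockCoord_apply_val]
    by_cases hν : ν = μ
    · subst hν
      rw [hval, Nat.succ_div_of_not_dvd hnd]
    · rw [shift_apply_of_ne L m x hν]
  · show ((shift μ x) μ : ℕ) % L = (x μ : ℕ) % L + 1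
    rw [hval, ← Nat.mod_add_mod, Nat.mod_eq_of_lt hk']

omit [NeZero L] in
/-- **face steps land on the near face of the next block**: if the offset along `μ` is `L − 1`, the offset of `x + e_μ` along `μ` is `0`. [folklore]
[cite: Balaban1985Averaging, (2) p.17] -/
theorem offset_shift_of_eq (x : TSite d (fineP L m)) {μ : Fin d} (hk : offset L m x μ + 1 = L) : offset L m (shift μ x) μ = 0 := by
  rw [offset_shift_self, hk, Nat.mod_self]

end Geometry

/-! ## §2 Block-modulated lifts of a coarse parameter at the flat background -/

section Lift

variable {d : ℕ} (L : ℕ) [NeZero L] (m : Fin d → ℕ)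
  {𝔸 : Type*} [Ring 𝔸] [Algebra ℂ 𝔸] {W : Type*} [NormedAddCommGroup W] [InnerProductSpace ℂ W] [FiniteDimensional ℂ W]
  (φ : W ≃ₗ[ℂ] 𝔸) (c₀ : ℝ) [Fact (0 < c₀)] (η : ℝ) (c₁ : ℝ) [Fact (0 < c₁)]

omit [FiniteDimensional ℂ W] [Fact (0 < c₀)] [Fact (0 < c₁)] in
/-- **`Q′(1)` OF A BLOCK-MODULATED LIFT**: for `u(x) = b(x)·ψ(blk x)` with `Σ_{x∈B(y)} b(x) = B` for every block, `(Q′(1)u)(y) = (L^{−d}B)·ψ(y)`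
(the flat `Q′` is the plain block mean — [B7] p. 27, re-derived here under `[Ring 𝔸]` as in `B5Eq155FlatAveragingCommute.QprimeW_one_apply`). [folklore]
[cite: Balaban1985BackgroundPropagators, (3.19) p.393; Balaban1985Averaging, p.27] -/
theorem QprimeW_one_lift (b : TSite d (fineP L m) → ℝ) {B : ℝ} (hB : ∀ y, ∑ x ∈ B9Eq319QprimeTorus.blockOf L m y, b x = B) (ψ : SiteL2K ℂ d m c₁ W) :
    QprimeW L m φ (fun _ : Bond d (fineP L m) => (1 : 𝔸ˣ)) (c₀ := c₀)
        ((WL2.equiv ℂ (fun _ : TSite d (fineP L m) => c₀) W).symm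
          (fun x => ((b x : ℝ) : ℂ) • WL2.equiv ℂ (fun _ : TSite d m => c₁) W ψ (blockCoord L m x))) =
      fun y => (((((L : ℝ) ^ d)⁻¹ * B : ℝ) : ℂ)) • WL2.equiv ℂ (fun _ : TSite d m => c₁) W ψ y := by
  funext y
  -- the flat `Q′` is the plain block mean (as `B5Eq155FlatAveragingCommute.QprimeW_one_apply`, here under `[Ring 𝔸]`)
  rw [QprimeW, LinearMap.comp_apply, LinearEquiv.coe_toLinearMap, WL2.linearEquiv_apply, QprimeLin_apply]
  have hflat : (fun bd : Bond d (fineP L m) => (adTransportW φ (fun _ : Bond d (fineP L m) => (1 : 𝔸ˣ)) bd).restrictScalars ℝ) =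
      fun _ => LinearMap.id := by
    funext bd; rw [adTransportW_one, LinearMap.restrictScalars_id]
  rw [hflat, Qprime_flat]
  have h : ∀ x ∈ B9Eq319QprimeTorus.blockOf L m y, ((L : ℝ) ^ d)⁻¹ • (WL2.equiv ℂ (fun _ : TSite d (fineP L m) => c₀) W
      ((WL2.equiv ℂ (fun _ : TSite d (fineP L m) => c₀) W).symm
        (fun x => ((b x : ℝ) : ℂ) • WL2.equiv ℂ (fun _ : TSite d m => c₁) W ψ (blockCoord L m x))) x) =
      (((((L : ℝ) ^ d)⁻¹ * b x : ℝ) : ℂ)) • WL2.equiv ℂ (fun _ : TSite d m => c₁) W ψ y := by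
    intro x hx
    rw [Equiv.apply_symm_apply, (mem_blockOf_iff L m y x).1 hx, RCLike.real_smul_eq_coe_smul (K := ℂ), smul_smul]
    push_cast
    rfl
  rw [Finset.sum_congr rfl h, ← Finset.sum_smul]
  congr 1
  rw [← hB y]
  push_cast
  rw [Finset.mul_sum]

omit [FiniteDimensional ℂ W] [Fact (0 < c₀)] [Fact (0 < c₁)] in
/-- **… READ IN THE COARSE `L²` SPACE: `Q̃′(1)u = (L^{−d}B)·ψ`** (the reading of `B9Eq3119DeltaPiCarrier.laplacePrimeA`'s penalty). [folklore]
[cite: Balaban1985BackgroundPropagators, (3.19) p.393, (3.24) p.394] -/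
theorem QprimeWL2_one_lift (b : TSite d (fineP L m) → ℝ) {B : ℝ} (hB : ∀ y, ∑ x ∈ B9Eq319QprimeTorus.blockOf L m y, b x = B) (ψ : SiteL2K ℂ d m c₁ W) :
    ((WL2.linearEquiv ℂ ℂ (fun _ : TSite d m => c₁)).symm.toLinearMap ∘ₗ QprimeW L m φ (fun _ : Bond d (fineP L m) => (1 : 𝔸ˣ)) (c₀ := c₀))
        ((WL2.equiv ℂ (fun _ : TSite d (fineP L m) => c₀) W).symm
          (fun x => ((b x : ℝ) : ℂ) • WL2.equiv ℂ (fun _ : TSite d m => c₁) W ψ (blockCoord L m x))) =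
      (((((L : ℝ) ^ d)⁻¹ * B : ℝ) : ℂ)) • ψ := by
  rw [LinearMap.comp_apply, QprimeW_one_lift L m φ c₀ c₁ b hB ψ, LinearEquiv.coe_toLinearMap, WL2.linearEquiv_symm_apply]
  rfl

omit [FiniteDimensional ℂ W] in
/-- **THE DIRICHLET FORM OF A BLOCK-MODULATED LIFT AT THE FLAT BACKGROUND**: if every forward step changes `u = b·(ψ∘blk)` by at most
`D·‖ψ(blk x)‖`, then `‖η⁻¹D₁u‖² ≤ |η|⁻²·D²·d·(c₀L^d∕c₁)·‖ψ‖²` (the `d·L^d` bonds of a block, the block partition, the weights `η^d` of (3.11)). [folklore]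
[cite: Balaban1985BackgroundPropagators, (3.3) p.390, (3.11) p.392] -/
theorem norm_sq_covDerivL2K_lift_le (b : TSite d (fineP L m) → ℝ) {D : ℝ} (ψ : SiteL2K ℂ d m c₁ W)
    (hstep : ∀ (x : TSite d (fineP L m)) (μ : Fin d),
      ‖((b (shift μ x) : ℝ) : ℂ) • WL2.equiv ℂ (fun _ : TSite d m => c₁) W ψ (blockCoord L m (shift μ x)) -
          ((b x : ℝ) : ℂ) • WL2.equiv ℂ (fun _ : TSite d m => c₁) W ψ (blockCoord L m x)‖ ≤
        D * ‖WL2.equiv ℂ (fun _ : TSite d m => c₁) W ψ (blockCoord L m x)‖) :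
    ‖covDerivL2K ℂ c₀ ((η : ℂ))⁻¹ (adTransportW φ (fun _ : Bond d (fineP L m) => (1 : 𝔸ˣ)))
        ((WL2.equiv ℂ (fun _ : TSite d (fineP L m) => c₀) W).symm
          (fun x => ((b x : ℝ) : ℂ) • WL2.equiv ℂ (fun _ : TSite d m => c₁) W ψ (blockCoord L m x)))‖ ^ 2 ≤
      ‖((η : ℂ))⁻¹‖ ^ 2 * D ^ 2 * (d : ℝ) * (c₀ * (L : ℝ) ^ d / c₁) * ‖ψ‖ ^ 2 := by
  have hc₀ : 0 < c₀ := Fact.out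
  have hc₁ : 0 < c₁ := Fact.out
  set ψt := WL2.equiv ℂ (fun _ : TSite d m => c₁) W ψ with hψt
  set ut : TSite d (fineP L m) → W := fun x => ((b x : ℝ) : ℂ) • ψt (blockCoord L m x) with hut
  rw [WL2.norm_sq]
  -- pointwise: `‖(Du)(x, μ)‖ ≤ |η⁻¹|·D·‖ψ(blk x)‖`
  have hpt : ∀ bnd : Bond d (fineP L m), c₀ * ‖WL2.equiv ℂ (fun _ : Bond d (fineP L m) => c₀) W
      (covDerivL2K ℂ c₀ ((η : ℂ))⁻¹ (adTransportW φ (fun _ : Bond d (fineP L m) => (1 : 𝔸ˣ)))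
        ((WL2.equiv ℂ (fun _ : TSite d (fineP L m) => c₀) W).symm ut)) bnd‖ ^ 2 ≤
      c₀ * (‖((η : ℂ))⁻¹‖ * D * ‖ψt (blockCoord L m bnd.1)‖) ^ 2 := by
    intro bnd
    refine mul_le_mul_of_nonneg_left (pow_le_pow_left₀ (norm_nonneg _) ?_ 2) hc₀.le
    rw [equiv_covDerivL2K, covDeriv_apply, adTransportW_one, LinearMap.id_apply, Equiv.apply_symm_apply, norm_smul, mul_assoc]
    refine mul_le_mul_of_nonneg_left ?_ (norm_nonneg _)
    exact hstep bnd.1 bnd.2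
  refine (Finset.sum_le_sum fun bnd _ => hpt bnd).trans ?_
  -- sum over bonds = sum over sites × directions; block partition; weights
  have hsum : ∑ bnd : Bond d (fineP L m), c₀ * (‖((η : ℂ))⁻¹‖ * D * ‖ψt (blockCoord L m bnd.1)‖) ^ 2 =
      c₀ * ‖((η : ℂ))⁻¹‖ ^ 2 * D ^ 2 * ((d : ℝ) * ((L : ℝ) ^ d * ∑ y, ‖ψt y‖ ^ 2)) := by
    have hblk : ∑ x : TSite d (fineP L m), ‖ψt (blockCoord L m x)‖ ^ 2 = (L : ℝ) ^ d * ∑ y, ‖ψt y‖ ^ 2 := by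
      rw [← sum_blockOf_sum L m (fun x => ‖ψt (blockCoord L m x)‖ ^ 2), Finset.mul_sum]
      refine Finset.sum_congr rfl fun y _ => ?_
      rw [Finset.sum_congr rfl fun x hx => by rw [(mem_blockOf_iff L m y x).1 hx], Finset.sum_const, card_blockOf, nsmul_eq_mul,
        Nat.cast_pow]
    rw [Fintype.sum_prod_type]
    simp only [Finset.sum_const, Finset.card_univ, Fintype.card_fin, nsmul_eq_mul]
    rw [← hblk, Finset.mul_sum, Finset.mul_sum]
    exact Finset.sum_congr rfl fun x _ => by ring
  rw [hsum]
  have hψ : ‖ψ‖ ^ 2 = c₁ * ∑ y, ‖ψt y‖ ^ 2 := by rw [WL2.norm_sq, Finset.mul_sum]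
  rw [hψ]
  refine le_of_eq ?_
  field_simp

/-- **THE FORM OF `Δ′_a(1)`**: `re⟪u, Δ′_a(1)u⟫ = ‖η⁻¹D₁u‖² + a′‖Q̃′(1)u‖²` for every `u` (`D* = D†` at the flat, mutually adjoint
transporters — `inner_covDivL2K_covDerivL2K`, `hRS_one`; the penalty through `adjoint_inner_right`). [folklore]
[cite: Balaban1985BackgroundPropagators, (3.24) p.394, (3.10) p.392] -/
theorem re_inner_laplacePrimeA_one (a' : ℝ) (u : SiteL2K ℂ d (fineP L m) c₀ W) :
    RCLike.re ⟪u, laplacePrimeA L m φ η (fun _ : Bond d (fineP L m) => (1 : 𝔸ˣ)) a' (c₀ := c₀) (c₁ := c₁) u⟫_ℂ =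
      ‖covDerivL2K ℂ c₀ ((η : ℂ))⁻¹ (adTransportW φ (fun _ : Bond d (fineP L m) => (1 : 𝔸ˣ))) u‖ ^ 2 +
        a' * ‖((WL2.linearEquiv ℂ ℂ (fun _ : TSite d m => c₁)).symm.toLinearMap ∘ₗ
          QprimeW L m φ (fun _ : Bond d (fineP L m) => (1 : 𝔸ˣ)) (c₀ := c₀)) u‖ ^ 2 := by
  have hc : conj (((η : ℂ))⁻¹) = ((η : ℂ))⁻¹ := by rw [map_inv₀, Complex.conj_ofReal]
  have T1 : RCLike.re ⟪u, covLaplaceSiteK ((η : ℂ))⁻¹ (adTransportW φ (fun _ : Bond d (fineP L m) => (1 : 𝔸ˣ)))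
      (adTransportW φ fun _ : Bond d (fineP L m) => (1 : 𝔸ˣ)⁻¹) u⟫_ℂ =
      ‖covDerivL2K ℂ c₀ ((η : ℂ))⁻¹ (adTransportW φ (fun _ : Bond d (fineP L m) => (1 : 𝔸ˣ))) u‖ ^ 2 := by
    rw [covLaplaceSiteK, LinearMap.comp_apply, inner_covDivL2K_covDerivL2K _ hc _ _ (hRS_one φ), ← RCLike.ofReal_pow, RCLike.ofReal_re]
  have T2 : ∀ (Q : SiteL2K ℂ d (fineP L m) c₀ W →ₗ[ℂ] SiteL2K ℂ d m c₁ W),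
      RCLike.re ⟪u, ((a' : ℂ) • (LinearMap.adjoint Q ∘ₗ Q)) u⟫_ℂ = a' * ‖Q u‖ ^ 2 := by
    intro Q
    rw [LinearMap.smul_apply, inner_smul_right, LinearMap.comp_apply, LinearMap.adjoint_inner_right, ← inner_self_eq_norm_sq (𝕜 := ℂ)]
    simp only [RCLike.re_to_complex, Complex.re_ofReal_mul]
  rw [laplacePrimeA, LinearMap.add_apply, inner_add_right, map_add, T1, T2]

omit [FiniteDimensional ℂ W] in
/-- **`‖Q̃′(1)‖² ≤ c₁∕(c₀L^d)`** — the flat block mean from the fine `L²(c₀)` to the coarse `L²(c₁)` (Jensen on each block + the block partition).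
[folklore] [cite: Balaban1985BackgroundPropagators, (3.19) p.393, (3.11) p.392] -/
theorem norm_sq_QprimeWL2_one_le (v : SiteL2K ℂ d (fineP L m) c₀ W) :
    ‖((WL2.linearEquiv ℂ ℂ (fun _ : TSite d m => c₁)).symm.toLinearMap ∘ₗ
        QprimeW L m φ (fun _ : Bond d (fineP L m) => (1 : 𝔸ˣ)) (c₀ := c₀)) v‖ ^ 2 ≤ c₁ / (c₀ * (L : ℝ) ^ d) * ‖v‖ ^ 2 := by
  have hc₀ : 0 < c₀ := Fact.out
  have hc₁ : 0 < c₁ := Fact.out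
  have hL : (0 : ℝ) < (L : ℝ) ^ d := by
    have : (0 : ℝ) < L := by exact_mod_cast Nat.pos_of_ne_zero (NeZero.ne L)
    positivity
  set vt := WL2.equiv ℂ (fun _ : TSite d (fineP L m) => c₀) W v with hvt
  rw [WL2.norm_sq, WL2.norm_sq]
  -- pointwise Jensen: `‖(Q′(1)v)(y)‖² ≤ L^{−d} Σ_{x∈B(y)} ‖v(x)‖²`
  have hpt : ∀ y : TSite d m, c₁ * ‖WL2.equiv ℂ (fun _ : TSite d m => c₁) W
      (((WL2.linearEquiv ℂ ℂ (fun _ : TSite d m => c₁)).symm.toLinearMap ∘ₗ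
        QprimeW L m φ (fun _ : Bond d (fineP L m) => (1 : 𝔸ˣ)) (c₀ := c₀)) v) y‖ ^ 2 ≤
      c₁ * (((L : ℝ) ^ d)⁻¹ * ∑ x ∈ B9Eq319QprimeTorus.blockOf L m y, ‖vt x‖ ^ 2) := by
    intro y
    refine mul_le_mul_of_nonneg_left ?_ hc₁.le
    rw [LinearMap.comp_apply, LinearEquiv.coe_toLinearMap, WL2.linearEquiv_symm_apply, Equiv.apply_symm_apply]
    rw [QprimeW, LinearMap.comp_apply, LinearEquiv.coe_toLinearMap, WL2.linearEquiv_apply, QprimeLin_apply]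
    have hflat : (fun bd : Bond d (fineP L m) => (adTransportW φ (fun _ : Bond d (fineP L m) => (1 : 𝔸ˣ)) bd).restrictScalars ℝ) =
        fun _ => LinearMap.id := by
      funext bd; rw [adTransportW_one, LinearMap.restrictScalars_id]
    rw [hflat, Qprime_flat]
    have h1 : ‖∑ x ∈ B9Eq319QprimeTorus.blockOf L m y, ((L : ℝ) ^ d)⁻¹ • vt x‖ ≤ ((L : ℝ) ^ d)⁻¹ * ∑ x ∈ B9Eq319QprimeTorus.blockOf L m y, ‖vt x‖ := by
      refine (norm_sum_le _ _).trans (le_of_eq ?_)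
      rw [Finset.mul_sum]
      exact Finset.sum_congr rfl fun x _ => by rw [norm_smul, norm_inv, norm_pow, Real.norm_natCast]
    exact (pow_le_pow_left₀ (norm_nonneg _) h1 2).trans (blockMean_norm_sq_le L m vt y)
  refine (Finset.sum_le_sum fun y _ => hpt y).trans (le_of_eq ?_)
  rw [← Finset.mul_sum, ← Finset.mul_sum, sum_blockOf_sum L m (fun x => ‖vt x‖ ^ 2), Finset.mul_sum, Finset.mul_sum, Finset.mul_sum]
  refine Finset.sum_congr rfl fun x _ => ?_
  rw [hvt]
  field_simp

end Lift

/-! ## §3 The tent on the blocks: step bound and block sum -/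

section Tent

variable {d : ℕ} (L : ℕ) [NeZero L] (m : Fin d → ℕ) [∀ i, NeZero (fineP L m i)] {W : Type*} [NormedAddCommGroup W] [NormedSpace ℂ W]

/-- **THE TENT's BLOCK SUM**: `Σ_{x∈B(y)} Π_μ k_μ(x)(L−1−k_μ(x)) = (Σ_{k<L} k(L−1−k))^d` (offsets parametrise the block; the sum of a product
of one-coordinate functions factorises) — the block normalisation of the variational test field. [folklore]
[cite: Balaban1984PropagatorsII, (2.74)–(2.77) p.236] -/
theorem sum_blockOf_tent (y : TSite d m) :
    ∑ x ∈ B9Eq319QprimeTorus.blockOf L m y, ∏ μ, ((offset L m x μ : ℕ) : ℝ) * ((L : ℝ) - 1 - (offset L m x μ : ℕ)) =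
      (∑ k ∈ Finset.range L, (k : ℝ) * ((L : ℝ) - 1 - k)) ^ d := by
  rw [sum_blockOf_eq_sum_boxVec]
  simp only [offset_perSite_cornerSite_add_boxVec]
  rw [← Fin.sum_univ_eq_sum_range (fun k => (k : ℝ) * ((L : ℝ) - 1 - k)) L]
  have h : (∏ _μ : Fin d, ∑ k : Fin L, ((k : ℕ) : ℝ) * ((L : ℝ) - 1 - ((k : ℕ) : ℝ))) =
      (∑ k : Fin L, ((k : ℕ) : ℝ) * ((L : ℝ) - 1 - ((k : ℕ) : ℝ))) ^ d := by
    rw [Finset.prod_const, Finset.card_univ, Fintype.card_fin]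
  rw [← h, Fintype.prod_sum]

omit [∀ i, NeZero (fineP L m i)] in
/-- **THE TENT IS `L·(L²∕4)^{d−1}`-LIPSCHITZ PER FORWARD STEP, WITH THE COARSE VALUE FROZEN**: for `u(x) = t(x)·ψ(blk x)`,
`‖u(x + e_μ) − u(x)‖ ≤ L·(L²∕4)^{d−1}·‖ψ(blk x)‖` — inside a block the block coordinate is unchanged and one factor moves by `≤ L` while the
others are `≤ L²∕4`; across a face BOTH values vanish (the tent is zero on the two faces `k_μ ∈ {0, L−1}`) — the energy bound of the variational
test field for [B6]'s lower bound of `Q′G′Q′*`. [folklore] [cite: Balaban1984PropagatorsII, (2.74)–(2.77) p.236; Balaban1985Averaging, (2) p.17] -/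
theorem norm_tent_step_le (ψt : TSite d m → W) (x : TSite d (fineP L m)) (μ : Fin d) :
    ‖((∏ ν, ((offset L m (shift μ x) ν : ℕ) : ℝ) * ((L : ℝ) - 1 - (offset L m (shift μ x) ν : ℕ)) : ℝ) : ℂ) • ψt (blockCoord L m (shift μ x)) -
        ((∏ ν, ((offset L m x ν : ℕ) : ℝ) * ((L : ℝ) - 1 - (offset L m x ν : ℕ)) : ℝ) : ℂ) • ψt (blockCoord L m x)‖ ≤
      (L : ℝ) * ((L : ℝ) ^ 2 / 4) ^ (d - 1) * ‖ψt (blockCoord L m x)‖ := by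
  have hkL : offset L m x μ + 1 ≤ L := offset_lt L m x μ
  rcases hkL.lt_or_eq with hlt | heq
  · -- interior step
    obtain ⟨hblk, hoff⟩ := blockCoord_shift_of_lt L m x hlt
    set R : ℝ := ∏ ν ∈ Finset.univ.erase μ, ((offset L m x ν : ℕ) : ℝ) * ((L : ℝ) - 1 - (offset L m x ν : ℕ)) with hR
    have hR0 : 0 ≤ R := Finset.prod_nonneg fun ν _ => profile_nonneg (offset_lt L m x ν)
    have hRle : R ≤ ((L : ℝ) ^ 2 / 4) ^ (d - 1) := by
      have h := Finset.prod_le_prod (s := Finset.univ.erase μ) (fun ν _ => profile_nonneg (offset_lt L m x ν)) (fun ν _ => profile_le L (offset L m x ν))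
      rw [Finset.prod_const, Finset.card_erase_of_mem (Finset.mem_univ μ), Finset.card_univ, Fintype.card_fin] at h
      exact h
    have e1 : (∏ ν, ((offset L m x ν : ℕ) : ℝ) * ((L : ℝ) - 1 - (offset L m x ν : ℕ))) =
        (((offset L m x μ : ℕ) : ℝ) * ((L : ℝ) - 1 - (offset L m x μ : ℕ))) * R :=
      (Finset.mul_prod_erase Finset.univ _ (Finset.mem_univ μ)).symm
    have e2 : (∏ ν, ((offset L m (shift μ x) ν : ℕ) : ℝ) * ((L : ℝ) - 1 - (offset L m (shift μ x) ν : ℕ))) =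
        ((((offset L m x μ : ℕ) : ℝ) + 1) * ((L : ℝ) - 1 - (((offset L m x μ : ℕ) : ℝ) + 1))) * R := by
      rw [← Finset.mul_prod_erase Finset.univ _ (Finset.mem_univ μ), hoff]
      push_cast
      congr 1
      exact Finset.prod_congr rfl fun ν hν => by rw [offset_shift_of_ne L m x (Finset.ne_of_mem_erase hν)]
    rw [hblk, e1, e2, ← sub_smul, ← Complex.ofReal_sub, norm_smul, Complex.norm_real, Real.norm_eq_abs, ← sub_mul, abs_mul,
      abs_of_nonneg hR0]
    refine mul_le_mul_of_nonneg_right ?_ (norm_nonneg _)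
    exact mul_le_mul (abs_profile_succ_sub_le hlt) hRle hR0 (Nat.cast_nonneg L)
  · -- face step: both vanish
    have h1 : (∏ ν, ((offset L m x ν : ℕ) : ℝ) * ((L : ℝ) - 1 - (offset L m x ν : ℕ))) = 0 :=
      Finset.prod_eq_zero (Finset.mem_univ μ) (profile_last heq)
    have h2 : (∏ ν, ((offset L m (shift μ x) ν : ℕ) : ℝ) * ((L : ℝ) - 1 - (offset L m (shift μ x) ν : ℕ))) = 0 :=
      Finset.prod_eq_zero (Finset.mem_univ μ) (by rw [offset_shift_of_eq L m x heq]; simp)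
    rw [h1, h2, Complex.ofReal_zero, zero_smul, zero_smul, sub_zero, norm_zero]
    have hL : (0 : ℝ) ≤ L := Nat.cast_nonneg L
    positivity

end Tent

end Literature.MathematicalPhysics.QuantumFieldTheory.Balaban1983to89.B9Eq319BlockTentLift

end
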